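import Summits.ValiantsHypothesis.ValiantsHypothesis.Theorems.LacunarySymmetroidMatrixDescartesCensusDoorA34EqualDiagonalChart

/-!
# `MatrixDescartes` census — DOOR A at `(3,4)`: ROOT-PINNING LAWS in the equal-diagonal chart (E), class R4 —
# at a determinant root of `δ·I + H` (`H` hollow) the middle type is EXACTLY `p·|δ| ≤ 3|αβγ|`, the extreme type `3|αβγ| ≤ p·|δ|`,
# and a middle root is pinned to `2|αβγ| ≤ p·|δ| ≤ 3|αβγ|` (`p = α² + β² + γ²`)

HONEST FRAMING.  Object-search cell `pub-symmetroid`, door-A seat `val-sym-door-p3` (g21); helper `--supports` the OPEN item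
stmt-ValiantsHypothesis-19980 `DoorA34 = PosRootLawAt 3 4 18` (route item `Theses.LacunarySymmetroid.DoorA34`), asserted nowhere here.
By `…CensusDoorA34ChartAtlas.doorA34_iff_chartRows` the door is equivalent to the rows of the two sixteen-parameter charts; this file records
exact LAWS AT A ROOT for the really-split chart (E) with equal signs (class R4), `M = [[δ,α,β],[α,δ,γ],[β,γ,δ]] = δ·I + H` with `H` hollow, whose
determinant is `δ³ − pδ + 2αβγ` (`…EqualDiagonalChart.det_equalDiag`, `p := α²+β²+γ²`):

* `trace_adjugate_equalDiag` — `tr adj M = 3δ² − p` (the TYPE sign of the cell: `< 0` middle / real line pair, `> 0` extreme / conjugate pair);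
* `root_identity_equalDiag` — at a root, `2αβγ = δ(p − δ²)`;
* `amgm_three_sq`, `three_sq_le_four_normSq_of_root` — at a root, `3δ² ≤ 4p` (AM–GM; `27δ²(p−δ²)² − 4p³ = (3δ²−4p)(3δ²−p)²`), i.e. `−δ` is an
  eigenvalue of the traceless `H`, whose eigenvalues satisfy `λ² ≤ ⅔‖H‖²`;
* **`middle_pinning_equalDiag`** — at a root of MIDDLE type (`tr adj M < 0`): `0 ≤ δ·(αβγ)` and `2|αβγ| ≤ p|δ| ≤ 3|αβγ|`; in the seat's notation
  the root ratio `θ := pδ/(αβγ)` lies in `[2,3]` (the middle eigenvalue of a hollow symmetric matrix is `−θ'·2αβγ/p`, `θ' ∈ [1, 3/2]`);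
* **`extreme_pinning_equalDiag`** — at a root of EXTREME type (`0 < tr adj M`): `3|αβγ| ≤ p|δ|`;
* `type_dichotomy_equalDiag` — hence the type of a simple root is READ OFF the side of `p|δ| = 3|αβγ|`;
* `eval_equalDiag_pencil`, `middle_pinning_pencil` — the same at every real root of an (E)-chart pencil `∑ₗ t^{dₗ}·[[δₗ,αₗ,βₗ],[αₗ,δₗ,γₗ],[βₗ,γₗ,δₗ]]`
  (all supports), with `δ(t) = ∑ₗ δₗt^{dₗ}` etc.

LOCATED READING (this seat, HOME/val-sym-door-p3/g21/DOOR-A34-P3G21-REPORT.md §2, not a theorem): on the five R4 seventeen-rows of the census of record,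
put in chart (E) exactly, EVERY one of the 85 roots is middle with `θ ∈ [2.0000, 2.0089]` (near-hollow: `δ² ≪ p`), and the eight graft roots of the
flag-eighteen sit at `θ = 3` to working precision (the middle/extreme boundary `tr adj = 0`, a rank-one corner).  Nothing here bounds `ζ_sym(3,4)`;
`DoorA34` stays OPEN; nothing bears on `MatrixDescartes` (stmt-ValiantsHypothesis-18050) or on `VP ≠ VNP`.
[folklore] Elementary algebra of one symmetric `3 × 3` matrix with equal diagonal; AM–GM.
-/

-- `Summit.ValiantsHypothesis.ValiantsHypothesis.…` repeats a component by the D-0017 layout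
-- (single-conjunct summit), which the `dupNamespace` linter flags; the name is mandated.
set_option linter.dupNamespace false

namespace Summit.ValiantsHypothesis.ValiantsHypothesis.Theorems.LacunarySymmetroidMatrixDescartes.Census.EqualDiagonal

open Matrix Finset
open scoped BigOperators

/-! ## 1. Trace of the adjugate and the root identity -/

/-- `tr adj [[δ,α,β],[α,δ,γ],[β,γ,δ]] = 3δ² − (α²+β²+γ²)` (sum of the three principal `2 × 2` minors). [folklore] -/
theorem trace_adjugate_equalDiag {R : Type*} [CommRing R] (δ α β γ : R) :
    (!![δ, α, β; α, δ, γ; β, γ, δ] : Matrix (Fin 3) (Fin 3) R).adjugate.trace = 3 * δ ^ 2 - (α ^ 2 + β ^ 2 + γ ^ 2) := by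
  rw [Matrix.adjugate_fin_three, Matrix.trace_fin_three]
  simp
  ring

/-- **Root identity.**  At a determinant root of the equal-diagonal matrix: `2αβγ = δ(α²+β²+γ² − δ²)`. [folklore] -/
theorem root_identity_equalDiag {R : Type*} [CommRing R] (δ α β γ : R)
    (h : (!![δ, α, β; α, δ, γ; β, γ, δ] : Matrix (Fin 3) (Fin 3) R).det = 0) :
    2 * α * β * γ = δ * (α ^ 2 + β ^ 2 + γ ^ 2 - δ ^ 2) := by
  rw [det_equalDiag] at h
  linear_combination h

/-! ## 2. AM–GM and the universal root bound `3δ² ≤ 4p` -/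

/-- AM–GM for three squares: `27·α²β²γ² ≤ (α²+β²+γ²)³`. [folklore] -/
theorem amgm_three_sq (α β γ : ℝ) : 27 * (α ^ 2 * β ^ 2 * γ ^ 2) ≤ (α ^ 2 + β ^ 2 + γ ^ 2) ^ 3 := by
  have hx : 0 ≤ α ^ 2 := sq_nonneg α
  have hy : 0 ≤ β ^ 2 := sq_nonneg β
  have hz : 0 ≤ γ ^ 2 := sq_nonneg γ
  set x := α ^ 2
  set y := β ^ 2
  set z := γ ^ 2
  nlinarith [mul_nonneg hx (sq_nonneg (y - z)), mul_nonneg hy (sq_nonneg (z - x)), mul_nonneg hz (sq_nonneg (x - y)),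
    mul_nonneg (add_nonneg (add_nonneg hx hy) hz) (add_nonneg (add_nonneg (sq_nonneg (x - y)) (sq_nonneg (y - z))) (sq_nonneg (z - x)))]

/-- **Universal root bound.**  At a determinant root of `[[δ,α,β],[α,δ,γ],[β,γ,δ]]`: `3δ² ≤ 4(α²+β²+γ²)` — `−δ` is an eigenvalue of the hollow
(traceless) part `H`, and eigenvalues of a traceless symmetric `3 × 3` matrix satisfy `λ² ≤ ⅔‖H‖²_F = 4p/3`.  Algebraically: the root identity and
AM–GM give `27δ²(p−δ²)² ≤ 4p³`, and `27δ²(p−δ²)² − 4p³ = (3δ²−4p)(3δ²−p)²`. [folklore] -/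
theorem three_sq_le_four_normSq_of_root (δ α β γ : ℝ)
    (h : (!![δ, α, β; α, δ, γ; β, γ, δ] : Matrix (Fin 3) (Fin 3) ℝ).det = 0) :
    3 * δ ^ 2 ≤ 4 * (α ^ 2 + β ^ 2 + γ ^ 2) := by
  have hr := root_identity_equalDiag δ α β γ h
  have ham := amgm_three_sq α β γ
  set p := α ^ 2 + β ^ 2 + γ ^ 2 with hp
  have hp0 : 0 ≤ p := by rw [hp]; positivity
  -- `27 δ² (p − δ²)² = 27·4·α²β²γ² ≤ 4 p³`
  have hsq : δ ^ 2 * (p - δ ^ 2) ^ 2 = 4 * (α ^ 2 * β ^ 2 * γ ^ 2) := by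
    have : δ * (p - δ ^ 2) = 2 * α * β * γ := by rw [hr]
    calc δ ^ 2 * (p - δ ^ 2) ^ 2 = (δ * (p - δ ^ 2)) ^ 2 := by ring
      _ = (2 * α * β * γ) ^ 2 := by rw [this]
      _ = 4 * (α ^ 2 * β ^ 2 * γ ^ 2) := by ring
  have key : (3 * δ ^ 2 - 4 * p) * (3 * δ ^ 2 - p) ^ 2 ≤ 0 := by
    have : (3 * δ ^ 2 - 4 * p) * (3 * δ ^ 2 - p) ^ 2 = 27 * (δ ^ 2 * (p - δ ^ 2) ^ 2) - 4 * p ^ 3 := by ring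
    rw [this, hsq]; nlinarith
  by_contra hlt
  push Not at hlt
  have h1 : 0 < 3 * δ ^ 2 - 4 * p := by linarith
  have h2 : 0 < (3 * δ ^ 2 - p) ^ 2 := by
    have : 0 < 3 * δ ^ 2 - p := by linarith
    positivity
  exact absurd key (not_le.mpr (mul_pos h1 h2))

/-! ## 3. Pinning of middle and extreme roots; the type dichotomy -/

/-- **MIDDLE-ROOT PINNING.**  At a determinant root of MIDDLE type (`tr adj < 0`, i.e. `3δ² < p`: the two non-zero eigenvalues have opposite signs —
the real-line-pair conic of the cell): `δ·αβγ ≥ 0` and `2|αβγ| ≤ p·|δ| ≤ 3|αβγ|` (`p = α²+β²+γ²`).  In words: the middle eigenvalue of the hollow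
part is pinned within a factor `3/2` of `−2αβγ/p`. [folklore] -/
theorem middle_pinning_equalDiag (δ α β γ : ℝ)
    (h : (!![δ, α, β; α, δ, γ; β, γ, δ] : Matrix (Fin 3) (Fin 3) ℝ).det = 0)
    (hmid : (!![δ, α, β; α, δ, γ; β, γ, δ] : Matrix (Fin 3) (Fin 3) ℝ).adjugate.trace < 0) :
    0 ≤ δ * (α * β * γ) ∧ 2 * |α * β * γ| ≤ (α ^ 2 + β ^ 2 + γ ^ 2) * |δ| ∧
      (α ^ 2 + β ^ 2 + γ ^ 2) * |δ| ≤ 3 * |α * β * γ| := by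
  have hr := root_identity_equalDiag δ α β γ h
  rw [trace_adjugate_equalDiag] at hmid
  set p := α ^ 2 + β ^ 2 + γ ^ 2 with hp
  have hp0 : 0 ≤ p := by rw [hp]; positivity
  have hq : 0 < p - δ ^ 2 := by nlinarith [sq_nonneg δ]
  have hprod : α * β * γ = δ * (p - δ ^ 2) / 2 := by linear_combination hr / 2
  refine ⟨?_, ?_, ?_⟩
  · rw [hprod]
    have : δ * (δ * (p - δ ^ 2) / 2) = δ ^ 2 * (p - δ ^ 2) / 2 := by ring
    rw [this]; positivity
  · rw [hprod, abs_div, abs_mul, abs_of_pos hq, abs_two]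
    nlinarith [abs_nonneg δ, sq_nonneg δ]
  · rw [hprod, abs_div, abs_mul, abs_of_pos hq, abs_two]
    nlinarith [abs_nonneg δ]

/-- **EXTREME-ROOT PINNING.**  At a determinant root of EXTREME type (`0 < tr adj`, i.e. `p < 3δ²`: the two non-zero eigenvalues share a sign —
the conjugate-line-pair / semidefinite conic): `3|αβγ| ≤ p·|δ|` (uses the universal bound `3δ² ≤ 4p`). [folklore] -/
theorem extreme_pinning_equalDiag (δ α β γ : ℝ)
    (h : (!![δ, α, β; α, δ, γ; β, γ, δ] : Matrix (Fin 3) (Fin 3) ℝ).det = 0)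
    (hext : 0 < (!![δ, α, β; α, δ, γ; β, γ, δ] : Matrix (Fin 3) (Fin 3) ℝ).adjugate.trace) :
    3 * |α * β * γ| ≤ (α ^ 2 + β ^ 2 + γ ^ 2) * |δ| := by
  have hr := root_identity_equalDiag δ α β γ h
  have h4 := three_sq_le_four_normSq_of_root δ α β γ h
  rw [trace_adjugate_equalDiag] at hext
  set p := α ^ 2 + β ^ 2 + γ ^ 2 with hp
  have hp0 : 0 ≤ p := by rw [hp]; positivity
  have hprod : α * β * γ = δ * (p - δ ^ 2) / 2 := by linear_combination hr / 2
  -- `|p − δ²| ≤ 2p/3`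
  have hle : |p - δ ^ 2| ≤ 2 * p / 3 := by
    rw [abs_le]; constructor <;> linarith
  rw [hprod, abs_div, abs_mul, abs_two]
  have hδ := abs_nonneg δ
  calc 3 * (|δ| * |p - δ ^ 2| / 2) ≤ 3 * (|δ| * (2 * p / 3) / 2) := by gcongr
    _ = p * |δ| := by ring

/-- **TYPE DICHOTOMY at a root** (both directions packaged): middle type forces `p|δ| ≤ 3|αβγ|`, extreme type forces `3|αβγ| ≤ p|δ|` — for a simple
root (`tr adj ≠ 0`, `…CensusDoorA34RootRank`) the type is read off the side of the hypersurface `p|δ| = 3|αβγ|`. [folklore] -/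
theorem type_dichotomy_equalDiag (δ α β γ : ℝ)
    (h : (!![δ, α, β; α, δ, γ; β, γ, δ] : Matrix (Fin 3) (Fin 3) ℝ).det = 0) :
    ((!![δ, α, β; α, δ, γ; β, γ, δ] : Matrix (Fin 3) (Fin 3) ℝ).adjugate.trace < 0 →
        (α ^ 2 + β ^ 2 + γ ^ 2) * |δ| ≤ 3 * |α * β * γ|) ∧
    (0 < (!![δ, α, β; α, δ, γ; β, γ, δ] : Matrix (Fin 3) (Fin 3) ℝ).adjugate.trace →
        3 * |α * β * γ| ≤ (α ^ 2 + β ^ 2 + γ ^ 2) * |δ|) :=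
  ⟨fun hmid => (middle_pinning_equalDiag δ α β γ h hmid).2.2, fun hext => extreme_pinning_equalDiag δ α β γ h hext⟩

/-! ## 4. Pencil form (all supports) -/

/-- The (E)-chart R4 pencil evaluated at `t` is the equal-diagonal matrix of the evaluated 4-nomials. [folklore] -/
theorem eval_equalDiag_pencil {K : ℕ} (d : Fin K → ℕ) (δ α β γ : Fin K → ℝ) (t : ℝ) :
    (∑ l, t ^ d l • (!![δ l, α l, β l; α l, δ l, γ l; β l, γ l, δ l] : Matrix (Fin 3) (Fin 3) ℝ))
      = !![∑ l, δ l * t ^ d l, ∑ l, α l * t ^ d l, ∑ l, β l * t ^ d l;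
           ∑ l, α l * t ^ d l, ∑ l, δ l * t ^ d l, ∑ l, γ l * t ^ d l;
           ∑ l, β l * t ^ d l, ∑ l, γ l * t ^ d l, ∑ l, δ l * t ^ d l] := by
  ext i j
  simp only [Matrix.sum_apply, Matrix.smul_apply, smul_eq_mul]
  fin_cases i <;> fin_cases j <;> simp [mul_comm]

/-- **Middle-root pinning along an (E)-chart R4 pencil (all supports).**  At every real `t` where the pencil `∑ₗ t^{dₗ}·[[δₗ,αₗ,βₗ],[αₗ,δₗ,γₗ],[βₗ,γₗ,δₗ]]`
is singular of middle type, the evaluated 4-nomials satisfy `δ(t)·(αβγ)(t) ≥ 0` and `2|αβγ(t)| ≤ p(t)|δ(t)| ≤ 3|αβγ(t)|`. [folklore] -/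
theorem middle_pinning_pencil {K : ℕ} (d : Fin K → ℕ) (δ α β γ : Fin K → ℝ) (t : ℝ)
    (h : (∑ l, t ^ d l • (!![δ l, α l, β l; α l, δ l, γ l; β l, γ l, δ l] : Matrix (Fin 3) (Fin 3) ℝ)).det = 0)
    (hmid : (∑ l, t ^ d l • (!![δ l, α l, β l; α l, δ l, γ l; β l, γ l, δ l] : Matrix (Fin 3) (Fin 3) ℝ)).adjugate.trace < 0) :
    0 ≤ (∑ l, δ l * t ^ d l) * ((∑ l, α l * t ^ d l) * (∑ l, β l * t ^ d l) * (∑ l, γ l * t ^ d l)) ∧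
    2 * |(∑ l, α l * t ^ d l) * (∑ l, β l * t ^ d l) * (∑ l, γ l * t ^ d l)|
        ≤ ((∑ l, α l * t ^ d l) ^ 2 + (∑ l, β l * t ^ d l) ^ 2 + (∑ l, γ l * t ^ d l) ^ 2) * |∑ l, δ l * t ^ d l| ∧
    ((∑ l, α l * t ^ d l) ^ 2 + (∑ l, β l * t ^ d l) ^ 2 + (∑ l, γ l * t ^ d l) ^ 2) * |∑ l, δ l * t ^ d l|
        ≤ 3 * |(∑ l, α l * t ^ d l) * (∑ l, β l * t ^ d l) * (∑ l, γ l * t ^ d l)| := by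
  rw [eval_equalDiag_pencil] at h hmid
  exact middle_pinning_equalDiag _ _ _ _ h hmid

end Summit.ValiantsHypothesis.ValiantsHypothesis.Theorems.LacunarySymmetroidMatrixDescartes.Census.EqualDiagonal
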